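import Summits.CriticalPhenomena.PercolationContinuityZ3.Theorems.Transplant.FKRayleighK4Normal
import HarnessLib

/-!
# `K₄` is Potts–Rayleigh for `0 < q ≤ 1` — file 4: edge-negative association of `φ_{w,q}` on every weighted graph with at most four vertices

Support file (`--supports stmt-CriticalPhenomena-4575`), FK sub-lane `prim-bschramm-fk-3` (gen 6) of the post-continuity
programme; builds on p205010 (kernel theorem, internal audit signed; external expert review pending).  No definitions, no named
facts, no sorries; standard axioms.

**`FK.edgeNegCorrOn_fin_four : 0 < q → q ≤ 1 → EdgeNegCorrOn (Fin 4) q`** — for every weight vector `w` on the pairs of `Fin 4`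
(loops allowed), every non-loop pair `e` and every pair `f ≠ e`: `φ_{w,q}(J_e ∩ J_f) ≤ φ_{w,q}(J_e)·φ_{w,q}(J_f)` ("`K₄` is
Potts–Rayleigh", Wagner 2008 Example 5.2, a computation credited to Sokal; `K₄` is the excluded minor of the series–parallel class of
Wagner's Theorem 5.8 / `Wagner2008_rc_edgeNegCorr_of_noK4Minor_holds`).  This file: loops (equality, `FK.rcMeasureW_real_inter_loop`) /
loop erasure; relabelling `Fin 4` (`rcMeasureW_real_preimage_relabel`) onto the two normal forms of `…FKRayleighK4Normal.lean`; then the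
corollaries by fk-2's `edgeNegCorrOn ⇒ …` lemmas: EC⁺, pairwise positive correlation of connection events, the hub inequality and
parameter-monotonicity of connection probabilities on four vertices for every `q ∈ (0,1)`; and NC on EVERY weighted graph with `≤ 4`
vertices (`edgeNegCorrOn_fin_of_le_four`, `edgeNegCorrOn_of_card_le_four`; `≤ 3` vertices by the discharged Wagner theorem).
[cite: Wagner2006, Ex. 5.2, Thm. 5.8] [cite: Grimmett2006, §3.9 eq. (3.94) (p. 63); §1.4 eq. (1.20) (p. 15); §4.3]
[cite: AyyerLinussonRavichandran2025, §7 eq. (13) (p. 22)]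
-/

noncomputable section

namespace Summit.CriticalPhenomena.PercolationContinuityZ3.Theorems

namespace FK

open MeasureTheory Set Literature.Probability.LatticeModels Literature.Probability.Percolation
open Literature.Probability.Percolation.DecisionTree (ind ind_of_mem ind_of_not_mem ind_nonneg)
open RayleighK4
open scoped Classical

/-! ### Relabelling `Fin 4` -/

/-- **Transfer of negative correlation along a relabelling** `σ : V' ≃ V`: if
`φ_{w ∘ σ}(J_{e'} ∩ J_{f'}) ≤ φ_{w∘σ}(J_{e'})φ_{w∘σ}(J_{f'})` with `σ e' = e`, `σ f' = f`, then `φ_w(J_e ∩ J_f) ≤ φ_w(J_e)φ_w(J_f)`.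
[cite: Grimmett2006, §4.3 (automorphism invariance)] -/
theorem nc_of_relabel {V V' : Type*} [Fintype V] [Fintype V'] (σ : V' ≃ V) (w : Sym2 V → unitInterval) {q : ℝ} (hq : 0 < q)
    {e f : Sym2 V} {e' f' : Sym2 V'} (he : sym2Equiv σ e' = e) (hf : sym2Equiv σ f' = f)
    (h : (rcMeasureW (w ∘ sym2Equiv σ) q ∅).real ({ω | e' ∈ ω} ∩ {ω | f' ∈ ω}) ≤
      (rcMeasureW (w ∘ sym2Equiv σ) q ∅).real {ω | e' ∈ ω} * (rcMeasureW (w ∘ sym2Equiv σ) q ∅).real {ω | f' ∈ ω}) :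
    (rcMeasureW w q ∅).real ({ω | e ∈ ω} ∩ {ω | f ∈ ω}) ≤
      (rcMeasureW w q ∅).real {ω | e ∈ ω} * (rcMeasureW w q ∅).real {ω | f ∈ ω} := by
  have key : ∀ A : Set (BondConfig V),
      (rcMeasureW w q ∅).real A = (rcMeasureW (w ∘ sym2Equiv σ) q ∅).real (BondConfig.relabel (sym2Equiv σ) ⁻¹' A) := by
    intro A
    rw [rcMeasureW_real_preimage_relabel σ w hq ∅ A, Set.image_empty]
  have hpre : ∀ (g : Sym2 V) (g' : Sym2 V'), sym2Equiv σ g' = g →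
      BondConfig.relabel (sym2Equiv σ) ⁻¹' {ω : BondConfig V | g ∈ ω} = {ω | g' ∈ ω} := by
    intro g g' hg
    ext ω
    rw [Set.mem_preimage, Set.mem_setOf_eq, Set.mem_setOf_eq, BondConfig.mem_relabel_iff, ← hg, Equiv.symm_apply_apply]
  rw [key, key, key, Set.preimage_inter, hpre e e' he, hpre f f' hf]
  exact h

/-- The remaining element of `Fin 4`. [folklore] -/
theorem fin4_exists_fourth (x y v : Fin 4) : ∃ z : Fin 4, z ≠ x ∧ z ≠ y ∧ z ≠ v := by
  revert x y v; decide

/-- A bijection of `Fin 4` with prescribed values on `0, 1, 2, 3` (given four distinct elements). [folklore] -/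
theorem fin4_exists_equiv (x y u v : Fin 4) (hxy : x ≠ y) (hxu : x ≠ u) (hxv : x ≠ v) (hyu : y ≠ u) (hyv : y ≠ v)
    (huv : u ≠ v) : ∃ σ : Fin 4 ≃ Fin 4, σ 0 = x ∧ σ 1 = y ∧ σ 2 = u ∧ σ 3 = v := by
  let g : Fin 4 → Fin 4 := fun i => if i = 0 then x else if i = 1 then y else if i = 2 then u else v
  have hg : Function.Injective g := by
    intro i j hij
    rcases (show ∀ i : Fin 4, i = 0 ∨ i = 1 ∨ i = 2 ∨ i = 3 by decide) i with rfl | rfl | rfl | rfl <;>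
      rcases (show ∀ j : Fin 4, j = 0 ∨ j = 1 ∨ j = 2 ∨ j = 3 by decide) j with rfl | rfl | rfl | rfl <;>
      simp +decide only [g, if_true, if_false] at hij <;> first | rfl | (exfalso; simp_all)
  refine ⟨Equiv.ofBijective g (Finite.injective_iff_bijective.1 hg), ?_, ?_, ?_, ?_⟩ <;>
    simp +decide [Equiv.ofBijective_apply, g]

/-- **Negative edge correlation on `Fin 4`, loop-free case**: every non-loop pair `e = xy` and every other non-loop pair `f = uv`.
[cite: Wagner2006, Ex. 5.2] -/
theorem nc_loopfree (w : Sym2 (Fin 4) → unitInterval) (hw : ∀ g : Sym2 (Fin 4), g.IsDiag → (w g : ℝ) = 0) {q : ℝ}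
    (hq0 : 0 < q) (hq1 : q ≤ 1) (x y u v : Fin 4) (hxy : x ≠ y) (huv : u ≠ v) (hne : s(u, v) ≠ s(x, y)) :
    (rcMeasureW w q ∅).real ({ω | s(x, y) ∈ ω} ∩ {ω | s(u, v) ∈ ω}) ≤
      (rcMeasureW w q ∅).real {ω | s(x, y) ∈ ω} * (rcMeasureW w q ∅).real {ω | s(u, v) ∈ ω} := by
  -- loop-freeness is preserved by relabelling
  have hwσ : ∀ σ : Fin 4 ≃ Fin 4, ∀ z : Fin 4, ((w ∘ sym2Equiv σ) s(z, z) : ℝ) = 0 := by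
    intro σ z
    exact hw _ (by rw [sym2Equiv_mk]; exact Sym2.mk_isDiag_iff.2 rfl)
  -- adjacent configuration with shared vertex `p`, `e = s(p, r)`, `f = s(p, s)`
  have adj : ∀ p r s' : Fin 4, p ≠ r → p ≠ s' → r ≠ s' →
      (rcMeasureW w q ∅).real ({ω | s(p, r) ∈ ω} ∩ {ω | s(p, s') ∈ ω}) ≤
        (rcMeasureW w q ∅).real {ω | s(p, r) ∈ ω} * (rcMeasureW w q ∅).real {ω | s(p, s') ∈ ω} := by
    intro p r s' hpr hps hrs
    obtain ⟨z, hzp, hzr, hzs⟩ := fin4_exists_fourth p r s'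
    obtain ⟨σ, h0, h1, h2, -⟩ := fin4_exists_equiv p r s' z hpr hps hzp.symm hrs hzr.symm hzs.symm
    refine nc_of_relabel σ w hq0 (e' := s(0, 1)) (f' := s(0, 2)) (by rw [sym2Equiv_mk, h0, h1])
      (by rw [sym2Equiv_mk, h0, h2]) ?_
    exact nc_norm_a (w ∘ sym2Equiv σ) (hwσ σ) hq0 hq1
  by_cases hux : u = x
  · subst hux
    have hvy : v ≠ y := fun h => hne (by rw [h])
    exact adj u y v hxy huv hvy.symm
  by_cases huy : u = y
  · subst huy
    have hvx : v ≠ x := fun h => hne (by rw [h, Sym2.eq_swap])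
    rw [show s(x, u) = s(u, x) from Sym2.eq_swap]
    exact adj u x v hxy.symm huv hvx.symm
  by_cases hvx : v = x
  · subst hvx
    rw [show s(u, v) = s(v, u) from Sym2.eq_swap]
    exact adj v y u hxy (Ne.symm hux) (Ne.symm huy)
  by_cases hvy : v = y
  · subst hvy
    rw [show s(x, v) = s(v, x) from Sym2.eq_swap, show s(u, v) = s(v, u) from Sym2.eq_swap]
    exact adj v x u hvx (Ne.symm huv) (Ne.symm hux)
  -- disjoint configuration
  obtain ⟨σ, h0, h1, h2, h3⟩ := fin4_exists_equiv x y u v hxy (Ne.symm hux) (Ne.symm hvx) (Ne.symm huy) (Ne.symm hvy) huv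
  refine nc_of_relabel σ w hq0 (e' := s(0, 1)) (f' := s(2, 3)) (by rw [sym2Equiv_mk, h0, h1])
    (by rw [sym2Equiv_mk, h2, h3]) ?_
  exact nc_norm_d (w ∘ sym2Equiv σ) (hwσ σ) hq0 hq1

/-! ### The theorem and its consequences -/

/-- **`K₄` is Potts–Rayleigh for every `0 < q ≤ 1`**: the random-cluster measure `φ_{w,q}` on the pairs of `Fin 4` — every
weighted graph with four vertices, loops allowed — is edge-negatively associated: `φ(J_e ∩ J_f) ≤ φ(J_e)·φ(J_f)` for `e` not a
loop and `f ≠ e`.  (Wagner 2008, Example 5.2; the first graph beyond the series–parallel class of Theorem 5.8.)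
[cite: Wagner2006, Ex. 5.2, Thm. 5.8] [cite: Grimmett2006, §3.9 eq. (3.94), Conj. (3.96) (pp. 63–64)] -/
theorem edgeNegCorrOn_fin_four {q : ℝ} (hq0 : 0 < q) (hq1 : q ≤ 1) : EdgeNegCorrOn (Fin 4) q := by
  intro w e f he hfe
  by_cases hf : f.IsDiag
  · -- `f` is a loop: an independent coin
    induction f using Sym2.ind with
    | h x' y' =>
      have hxy : x' = y' := Sym2.mk_isDiag_iff.1 hf
      subst hxy
      have hne : e ≠ s(x', x') := fun h => he (h ▸ Sym2.mk_isDiag_iff.2 rfl)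
      exact (rcMeasureW_real_inter_loop w hq0 x' hne).le
  · -- erase the loops, then the loop-free case
    rw [rcMeasureW_real_eraseLoops w hq0 _ (openPair_inter_loop_insensitive he hf),
      rcMeasureW_real_eraseLoops w hq0 _ (openPair_loop_insensitive he),
      rcMeasureW_real_eraseLoops w hq0 _ (openPair_loop_insensitive hf)]
    induction e using Sym2.ind with
    | h x y =>
      induction f using Sym2.ind with
      | h u v =>
        refine nc_loopfree _ (fun g hg => ?_) hq0 hq1 x y u v (fun h => he (Sym2.mk_isDiag_iff.2 h))
          (fun h => hf (Sym2.mk_isDiag_iff.2 h)) hfe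
        simp [hg]

/-- **Single-edge monotonicity of connection probabilities (EC⁺) on every weighted graph with four vertices, `0 < q < 1`.**
[cite: Grimmett2006, Thm. (3.21) (p. 43); §3.9 (p. 63)] -/
theorem edgeConnMonoOn_fin_four {q : ℝ} (hq0 : 0 < q) (hq1 : q < 1) : EdgeConnMonoOn (Fin 4) q :=
  edgeConnMonoOn_of_edgeNegCorrOn hq0 hq1 (edgeNegCorrOn_fin_four hq0 hq1.le)

/-- **Pairwise positive correlation of connection events on every weighted graph with four vertices, `0 < q < 1`** (the
`Fin 4` slice of the conjecture node `PairConnPosFKPos`; by FKG it also holds for `q ≥ 1`).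
[cite: AyyerLinussonRavichandran2025, §7 eq. (13)–(15) (p. 22)] [cite: Grimmett2006, §3.9 (p. 63)] -/
theorem pairConnPosUnder_fin_four {q : ℝ} (hq0 : 0 < q) (hq1 : q < 1) (w : Sym2 (Fin 4) → unitInterval) (x y u v : Fin 4) :
    PairConnPosUnder (rcMeasureW w q ∅) x y u v :=
  pairConnPosUnder_of_edgeNegCorrOn hq0 hq1 (edgeNegCorrOn_fin_four hq0 hq1.le) w x y u v

/-- **The hub inequality on every weighted graph with four vertices, `0 < q < 1`** (Ayyer–Linusson–Ravichandran's (13) at every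
hub of `K₄`). [cite: AyyerLinussonRavichandran2025, §7 eq. (13), Conj. 7.1 (p. 22)] -/
theorem hubUnder_fin_four {q : ℝ} (hq0 : 0 < q) (hq1 : q < 1) (w : Sym2 (Fin 4) → unitInterval) (o a b : Fin 4) :
    HubUnder (rcMeasureW w q ∅) o a b :=
  hubUnder_of_pairConnPosUnder _ o a b (pairConnPosUnder_fin_four hq0 hq1 w o a b a)

/-- **Connection probabilities are non-decreasing in every edge parameter on four vertices, `0 < q < 1`** — Grimmett's
comparison inequality (3.21) below `q = 1`, which is not in print (Grimmett 2006 §5.8), for all weighted graphs with four vertices.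
[cite: Grimmett2006, Thm. (3.21) (p. 43); §5.8 (p. 131)] -/
theorem rcMeasureW_real_openConn_mono_fin_four {q : ℝ} (hq0 : 0 < q) (hq1 : q < 1) {w w' : Sym2 (Fin 4) → unitInterval}
    (hww : ∀ e, w e ≤ w' e) (x y : Fin 4) :
    (rcMeasureW w q ∅).real (openConn x y) ≤ (rcMeasureW w' q ∅).real (openConn x y) :=
  rcMeasureW_real_openConn_mono_of_edgeConnMonoOn hq0 (edgeConnMonoOn_fin_four hq0 hq1) hww x y



/-! ### Every weighted graph with at most four vertices -/

/-- A `K₄` minor needs four vertices: four pairwise disjoint nonempty branch sets. [folklore] -/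
theorem four_le_card_of_hasK4Minor {V : Type*} [Fintype V] {G : SimpleGraph V} (hG : HasK4Minor G) : 4 ≤ Fintype.card V := by
  classical
  obtain ⟨B, hne, -, hdisj, -⟩ := hG
  choose g hg using hne
  have hinj : Function.Injective g := by
    intro i j hij
    by_contra hne'
    exact Set.disjoint_left.1 (hdisj i j hne') (hg i) (hij ▸ hg j)
  simpa using Fintype.card_le_of_injective g hinj

/-- **Edge-negative association of `φ_{w,q}` on every weighted graph with at most four vertices, `0 < q ≤ 1`**: on `Fin n`, `n ≤ 3`,
every support graph is `K₄`-minor-free (Wagner's theorem, discharged: `Wagner2008_rc_edgeNegCorr_of_noK4Minor_holds`), and `n = 4` is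
`edgeNegCorrOn_fin_four`. [cite: Wagner2006, Ex. 5.2, Thm. 5.8(d), §5.3] [cite: Grimmett2006, §3.9 eq. (3.94) (p. 63)] -/
theorem edgeNegCorrOn_fin_of_le_four {n : ℕ} (hn : n ≤ 4) {q : ℝ} (hq0 : 0 < q) (hq1 : q ≤ 1) : EdgeNegCorrOn (Fin n) q := by
  rcases Nat.lt_or_ge n 4 with hlt | hge
  · intro w e f he hfe
    refine Wagner2008_rc_edgeNegCorr_of_noK4Minor_holds n w q hq0 hq1 (fun hK => ?_) e f he hfe
    have := four_le_card_of_hasK4Minor hK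
    simp only [Fintype.card_fin] at this
    omega
  · obtain rfl : n = 4 := le_antisymm hn hge
    exact edgeNegCorrOn_fin_four hq0 hq1


/-- **Edge-negative association of `φ_{w,q}` on every finite vertex type with at most four elements, `0 < q ≤ 1`** (relabelling to
`Fin n`). [cite: Wagner2006, Ex. 5.2, §5.3] [cite: Grimmett2006, §3.9 eq. (3.94) (p. 63); §4.3] -/
theorem edgeNegCorrOn_of_card_le_four {V : Type*} [Fintype V] (hV : Fintype.card V ≤ 4) {q : ℝ} (hq0 : 0 < q) (hq1 : q ≤ 1) :
    EdgeNegCorrOn V q := by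
  classical
  intro w e f he hfe
  set σ : Fin (Fintype.card V) ≃ V := (Fintype.equivFin V).symm
  have hne' : (sym2Equiv σ).symm f ≠ (sym2Equiv σ).symm e := fun h => hfe ((sym2Equiv σ).symm.injective h)
  have hdiag : ∀ z : Sym2 (Fin (Fintype.card V)), z.IsDiag → (sym2Equiv σ z).IsDiag := by
    intro z hz
    induction z using Sym2.ind with
    | h a b => rw [sym2Equiv_mk, Sym2.mk_isDiag_iff]; exact congrArg σ (Sym2.mk_isDiag_iff.1 hz)
  have hde' : ¬ ((sym2Equiv σ).symm e).IsDiag := by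
    intro hd
    apply he
    rw [← (sym2Equiv σ).apply_symm_apply e]
    exact hdiag _ hd
  exact nc_of_relabel σ w hq0 ((sym2Equiv σ).apply_symm_apply e) ((sym2Equiv σ).apply_symm_apply f)
    (edgeNegCorrOn_fin_of_le_four hV hq0 hq1 (w ∘ sym2Equiv σ) _ _ hde' hne')

end FK

end Summit.CriticalPhenomena.PercolationContinuityZ3.Theorems

end
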